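import Mathlib
import Literature.AlgebraicGeometry.Resolution.CobordantGame
import Literature.AlgebraicGeometry.Resolution.FormalCoordinateChange
import Literature.RingTheory.MvPowerSeries.FrobeniusPowerBasis
import Literature.RingTheory.TwoVariableSeries.Basic
import Summits.ResolutionOfSingularities.ResolutionOfSingularities.Theorems.WeightedInvariantLocalWeightedDropMonicRecentre

/-!
# `WeightedInvariant.LocalWeightedDrop`, line `hasse-ridge-face-selection`: RE-CENTRING and CLEANING the purely
# inseparable forms `y^{p^e} + A₀(x')`

Crux item stmt-ResolutionOfSingularities-8899 `LocalWeightedDrop` (route `ResolutionOfSingularities/WeightedInvariant`),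
serving the door `WeightedConstruction` stmt-ResolutionOfSingularities-0571.  [OURS · L1 W4.3, chain w43, stub worker 1
(gen 2): first infrastructure for the piece S3πM `stub_wildPurelyInseparableReductionWon` (reduction of the purely
inseparable surface forms to the terminal ones) — the closure of the class `{y^{p^e} + A₀}` under re-centrings claimed in
REPORT v22(1), and Hauser–Perlega's «clean expansion» (PRIMS 60 (2024) §2, p. 774: «we may assume that … no `p^e`-th
powers appear in the expansion of `F`»).  Not a statement of any manuscript; elementary.]

* `won_purePower_recentre_iff` (every number `m` of variables `x'`, `d = p^e`): for `φ ∈ k[[x']]` with `φ(0) = 0`,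
  `Won (y^{p^e} + A₀ + φ^{p^e}) ↔ Won (y^{p^e} + A₀)` — the shear `y ↦ y + φ(x')` is a legal coordinate change and
  `(y + φ)^{p^e} = y^{p^e} + φ^{p^e}` (Frobenius additivity); so the purely inseparable class is RE-CENTRING-CLOSED and the
  datum of the sub-game is `A₀` modulo `p^e`-th powers.
* `exists_clean` (`k` perfect of characteristic `p`, e.g. algebraically closed): for `A₀(0) = 0` there is `φ` with
  `φ(0) = 0` such that `A₀ + φ^{p^e}` is CLEAN — no monomial `x'^{p^e·α}` survives (the `p^e`-adic component of `A₀` of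
  residue `0` is a `p^e`-th power over a perfect field: tree `Literature.RingTheory.MvPowerSeries.FrobeniusPowerBasis`).
* `won_iff_won_clean`: hence every `y^{p^e} + A₀` is won iff some CLEAN re-centred `y^{p^e} + A₀'` is.
-/

set_option linter.dupNamespace false -- mandated namespace of this single-conjunct summit

namespace Summit.ResolutionOfSingularities.ResolutionOfSingularities.Theorems

open Literature.AlgebraicGeometry.Resolution
open Literature.AlgebraicGeometry.Resolution.CobordantGame

namespace WildPurePower

open MvPowerSeries

variable {k : Type} [Field k] {m : ℕ}

/-- THE RE-CENTRED PURE POWER (characteristic `p`): `(y + φ)^{p^e} + A₀ = y^{p^e} + (A₀ + φ^{p^e})` under the shear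
`τ_φ = (x', y + φ(x'))`. -/
theorem subst_shear_purePower (p : ℕ) (hp : p.Prime) [CharP k p] (e : ℕ) (φ : MvPowerSeries (Fin m) k)
    (hφ : constantCoeff φ = 0) (A₀ : MvPowerSeries (Fin m) k) :
    subst (fun l : Fin (m + 1) => if l = Fin.last m then X (Fin.last m) + rename (Fin.succAboveEmb (Fin.last m)) φ else X l)
        (X (Fin.last m) ^ (p ^ e) + rename (Fin.succAboveEmb (Fin.last m)) A₀) =
      X (Fin.last m) ^ (p ^ e) + rename (Fin.succAboveEmb (Fin.last m)) (A₀ + φ ^ (p ^ e)) := by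
  haveI := Fact.mk hp
  haveI : CharP (MvPowerSeries (Fin (m + 1)) k) p :=
    Literature.RingTheory.TwoVariableSeries.charP_mvPowerSeries (Fin (m + 1)) p
  have h0 : ∀ l, constantCoeff ((fun l : Fin (m + 1) => if l = Fin.last m
      then X (Fin.last m) + rename (Fin.succAboveEmb (Fin.last m)) φ else X l) l) = 0 := by
    intro l
    dsimp only
    split_ifs
    · rw [map_add, constantCoeff_X, constantCoeff_rename, hφ, add_zero]
    · exact constantCoeff_X l
  have hs := hasSubst_of_constantCoeff_zero h0
  have hY : subst (fun l : Fin (m + 1) => if l = Fin.last m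
      then X (Fin.last m) + rename (Fin.succAboveEmb (Fin.last m)) φ else X l)
      (X (Fin.last m) : MvPowerSeries (Fin (m + 1)) k) =
      X (Fin.last m) + rename (Fin.succAboveEmb (Fin.last m)) φ := by
    rw [subst_X hs]
    exact if_pos rfl
  rw [← coe_substAlgHom hs]
  simp only [map_add, map_pow, coe_substAlgHom, hY, MonicRecentre.subst_shear_rename φ hφ]
  rw [add_pow_char_pow]
  ring

/-- RE-CENTRING A PURE POWER (characteristic `p`, every number of variables): for `φ ∈ k[[x']]` with `φ(0) = 0`,
`y^{p^e} + (A₀ + φ^{p^e})` is won iff `y^{p^e} + A₀` is — the purely inseparable class is re-centring-closed, its datum is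
`A₀` modulo `p^e`-th powers (the `p^e = 2` case is `won_monic_two_recentre_iff` with `A₁ = 0`). -/
theorem won_purePower_recentre_iff (p : ℕ) (hp : p.Prime) [CharP k p] (e : ℕ) (φ : MvPowerSeries (Fin m) k)
    (hφ : constantCoeff φ = 0) (A₀ : MvPowerSeries (Fin m) k) :
    CobordantGame.Won k (m + 1) (X (Fin.last m) ^ (p ^ e) + rename (Fin.succAboveEmb (Fin.last m)) (A₀ + φ ^ (p ^ e))) ↔
      CobordantGame.Won k (m + 1) (X (Fin.last m) ^ (p ^ e) + rename (Fin.succAboveEmb (Fin.last m)) A₀) := by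
  classical
  obtain ⟨τ, hτ⟩ : ∃ τ : Fin (m + 1) → MvPowerSeries (Fin (m + 1)) k,
      ∀ l, τ l = if l = Fin.last m then X (Fin.last m) + rename (Fin.succAboveEmb (Fin.last m)) φ else X l :=
    ⟨_, fun _ => rfl⟩
  have hτeq : τ = fun l : Fin (m + 1) => if l = Fin.last m
      then X (Fin.last m) + rename (Fin.succAboveEmb (Fin.last m)) φ else X l := funext hτ
  have hτ0 : ∀ l, constantCoeff (τ l) = 0 := by
    intro l
    rw [hτ]
    split_ifs
    · rw [map_add, constantCoeff_X, constantCoeff_rename, hφ, add_zero]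
    · exact constantCoeff_X l
  have hc1 : coeff (Finsupp.single (Fin.last m) 1) (rename (Fin.succAboveEmb (Fin.last m)) φ) = 0 := by
    have h := TschirnhausForm.coeff_emb_add_single_rename (m := m) (0 : Fin m →₀ ℕ) 1 φ
    rw [Finsupp.embDomain_zero, zero_add, if_neg one_ne_zero] at h
    exact h
  have hτdet : IsUnit (FormalCoordChange.linMat τ).det := by
    rw [FormalCoordChange.linMat, TschirnhausForm.det_of_offLast_rows]
    · rw [Matrix.of_apply, hτ, if_pos rfl, map_add, coeff_index_single_self_X, hc1, add_zero]
      exact isUnit_one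
    · intro l j hl
      rw [Matrix.of_apply, hτ, if_neg hl, coeff_index_single_X]
  rw [← subst_shear_purePower p hp e φ hφ A₀, ← hτeq]
  exact won_subst_iff hτ0 hτdet _

/-- CLEANING (`k` perfect of characteristic `p`): for `A₀(0) = 0` there is `φ ∈ k[[x']]` with `φ(0) = 0` such that
`A₀ + φ^{p^e}` has no monomial with all exponents divisible by `p^e` (Hauser–Perlega's clean expansion: the `p^e`-adic
component of residue `0` of `A₀` is a `p^e`-th power). -/
theorem exists_clean (p : ℕ) (hp : p.Prime) [CharP k p] [PerfectRing k p] (e : ℕ) (A₀ : MvPowerSeries (Fin m) k)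
    (hA : constantCoeff A₀ = 0) :
    ∃ φ : MvPowerSeries (Fin m) k, constantCoeff φ = 0 ∧
      ∀ β : Fin m →₀ ℕ, (∀ i, p ^ e ∣ β i) → coeff β (A₀ + φ ^ (p ^ e)) = 0 := by
  classical
  haveI := Fact.mk hp
  haveI : ExpChar k p := ExpChar.prime hp
  haveI : NeZero (p ^ e) := ⟨pow_ne_zero e hp.ne_zero⟩
  -- the residue-`0` component `ψ` of `A₀`, supported on `p^e ℕ^m`; `-ψ` is a `p^e`-th power `φ^{p^e}`
  set ψ := Literature.RingTheory.MvPowerSeries.modComponent (p ^ e) A₀ (fun _ => 0) with hψ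
  have hlift : Literature.RingTheory.MvPowerSeries.liftExp (p ^ e) (fun _ : Fin m => (0 : Fin (p ^ e))) = 0 := by
    ext i
    rw [Literature.RingTheory.MvPowerSeries.liftExp_apply, Fin.val_zero, Finsupp.coe_zero, Pi.zero_apply]
  have hψcoeff : ∀ β : Fin m →₀ ℕ, (∀ i, p ^ e ∣ β i) → coeff β ψ = coeff β A₀ := by
    intro β hβ
    rw [hψ, Literature.RingTheory.MvPowerSeries.coeff_modComponent, if_pos hβ, hlift, add_zero]
  have hnegsupp : Literature.RingTheory.MvPowerSeries.IsSupportedOnMultiples (p ^ e) (-ψ) := by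
    intro M hM
    rw [map_neg, Literature.RingTheory.MvPowerSeries.isSupportedOnMultiples_modComponent (p ^ e) A₀ _ M hM, neg_zero]
  obtain ⟨φ, hφ⟩ := Literature.RingTheory.MvPowerSeries.exists_pow_eq_of_isSupportedOnMultiples p hnegsupp
  refine ⟨φ, ?_, fun β hβ => ?_⟩
  · -- `φ(0)^{p^e} = -A₀(0) = 0`
    have h := Literature.RingTheory.MvPowerSeries.coeff_smul_pow_pow p φ e 0
    rw [smul_zero, hφ, map_neg, hψcoeff 0 (fun i => by simp), coeff_zero_eq_constantCoeff_apply, hA, neg_zero] at h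
    exact pow_eq_zero_iff (pow_ne_zero e hp.ne_zero) |>.mp h.symm
  · rw [map_add, hφ, map_neg, hψcoeff β hβ, add_neg_cancel]

/-- PURELY INSEPARABLE FORMS MAY BE ASSUMED CLEAN (`k` perfect of characteristic `p`): `y^{p^e} + A₀` (`A₀(0) = 0`) is won
iff the CLEAN re-centred form `y^{p^e} + (A₀ + φ^{p^e})` of `exists_clean` is; the order does not go down under cleaning
(`ord (A₀ + φ^{p^e}) ≥ min (ord A₀, p^e · ord φ)` is left to the user). -/
theorem won_iff_won_clean (p : ℕ) (hp : p.Prime) [CharP k p] [PerfectRing k p] (e : ℕ) (A₀ : MvPowerSeries (Fin m) k)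
    (hA : constantCoeff A₀ = 0) :
    ∃ φ : MvPowerSeries (Fin m) k, constantCoeff φ = 0 ∧
      (∀ β : Fin m →₀ ℕ, (∀ i, p ^ e ∣ β i) → coeff β (A₀ + φ ^ (p ^ e)) = 0) ∧
      (CobordantGame.Won k (m + 1) (X (Fin.last m) ^ (p ^ e) + rename (Fin.succAboveEmb (Fin.last m)) A₀) ↔
        CobordantGame.Won k (m + 1) (X (Fin.last m) ^ (p ^ e) +
          rename (Fin.succAboveEmb (Fin.last m)) (A₀ + φ ^ (p ^ e)))) := by
  obtain ⟨φ, hφ0, hclean⟩ := exists_clean p hp e A₀ hA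
  exact ⟨φ, hφ0, hclean, (won_purePower_recentre_iff p hp e φ hφ0 A₀).symm⟩

end WildPurePower

end Summit.ResolutionOfSingularities.ResolutionOfSingularities.Theorems
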